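import Literature.NumberTheory.EllipticCurves.JetchevSkinnerWan2017.SigmaImprimitiveCharIdeal
import Literature.NumberTheory.EllipticCurves.BigGaloisRepSelmer
import Literature.NumberTheory.EllipticCurves.PrimaryTorsionGaloisRep
import Literature.NumberTheory.EllipticCurves.IwasawaAlgebra
import HarnessLib

/-!
# The LOCAL term of the `Σ`-change at a place `w ∤ p`: the Pontryagin dual of `H¹(K_w, T_pE ⊗ Λ^*(Ψ⁻¹))`
# is a finitely generated torsion `Λ`-module and the Euler factor `P_w` lies in its characteristic ideal
# (away from the Tamagawa defect) — ONE named fact (statement only; proofs in `SigmaLocalCharIdealProofs.lean`)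

Cell `bsd-stepL` (K2 route `ErratumRoadFive`, support 20338 `RoadFFPublishedInputs`, child 20427
`JSWSigmaChangeNoTamagawaDefect`), seat `bsd-stepL-imc-p1` (prover g12, 2026-08-27). Statement-first: ONE
cite-tagged named fact (the purely LOCAL, per-place input). No `sorry`, no instance, no notation.

## Why this file

The Road-FF composition (`P2.RoadFF.SigmaDataAt`) consumes of [JSW17]'s `Σ`-change only the torsion of
`X^Σ_ac` and the ONE-SIDED inclusion `Ch_Λ(X^∅_ac) · (P_Σ) ⊆ Ch_Λ(X^Σ_ac)`. That inclusion needs NO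
surjectivity of localisation (JSW Prop. 3.3.2 ∕ Poitou–Tate): it is the exactness of
`0 → Sel^{Σ} → Sel^{Σ∪{w}} → H¹(K_w, M)` place by place, the exactness of `Hom(·, ℚ/ℤ)`, the
multiplicativity of `Ch_Λ` (tree: `BigGaloisRep.XBigDecomp.isTorsion_and_charIdeal_mul_span_prod_le`,
`Module.isTorsion_and_charIdeal_mul_span_le_of_exact_dual`), Shapiro's lemma ([SU14] Prop. 3.2.3, the
tree's `SkinnerUrban2014.prop323_XAc_equiv_XBigDecomp`) and ONE local input per place `w ∈ Σ₂ ∖ Σ₁`: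
"`H¹(K_w, M)^∨` is finitely generated `Λ`-torsion and `P_w ∈ Ch_Λ(H¹(K_w, M)^∨)`". This file types that
local input as the named fact `sigmaLocal_charIdeal_eulerFactor_mem_of_noTamagawaDefect` (statement only);
the sibling `SigmaLocalCharIdealProofs.lean` PROVES from it (`+` Shapiro `+` the torsion of `X^{Σ₁}_ac`) the
one-sided `Σ`-change in the shape of the corollaries of the composite fact
`prop332_charIdeal_XAc_sigma_change_of_noTamagawaDefect` (same directory), whose equality half and whose
Poitou–Tate input are thereby NOT needed by the road.

## Sources, verbatim

* [JetchevSkinnerWan2017] proof of Thm. 6.1.6 (arXiv:1512.06894 tex p0026 L82–96): "`χ_Λ(X^{Σ₂}_ac(M))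
  = χ_Λ(X^{Σ₁}_ac(M)) · χ_Λ(∏_{w∈Σ₂∖Σ₁} Hom_𝒪(H¹(𝒦_w, M)/H¹_{𝔉_ac}(𝒦_w, M), L/𝒪)) = χ_Λ(X^{Σ₁}_ac(M))
  ∏_{w∈Σ₂∖Σ₁} (P_w(ε⁻¹Ψ⁻¹(Frob_w)))`" — the LOCAL identity `χ_Λ(Hom_𝒪(H¹(𝒦_w, M)/H¹_{𝔉_ac}(𝒦_w, M), L/𝒪))
  = (P_w(ε⁻¹Ψ⁻¹(Frob_w)))` at each `w ∈ Σ₂ ∖ Σ₁`; §5.1 Remark (tex p0022 L42–56): "If `w = (ℓ)` is an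
  inert place in `𝒦`, then `Ψ(Frob_w) = 1` and … `P_w(ε⁻¹Ψ⁻¹(Frob_w)) = (1 − a_ℓ(f)ℓ⁻¹ + ℓ⁻¹)(1 + a_ℓ(f)ℓ⁻¹ + ℓ⁻¹)`,
  which can contribute to the `μ`-invariant".
* [Skinner2016PacificMC] §2.3 (p. 180): "Each `H¹(I_ℓ, 𝓜)^{G_{ℚ_ℓ}}`, `ℓ ≠ p`, is a cotorsion `Λ_𝒪`-module,
  and the `Λ_𝒪`-characteristic ideal of its Pontryagin dual is generated by `P_ℓ(Ψ⁻¹ε⁻¹(frob_ℓ))`, where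
  `P_ℓ(X) = det(1 − X·frob_ℓ ∣ V_{f,I_ℓ})`".
* [GreenbergVatsal2000] Prop. 2.4 (the cyclotomic analogue at `ℓ ≠ p`: `ℋ_ℓ` is `Λ`-cotorsion with
  characteristic ideal generated by `P_ℓ(ℓ⁻¹γ_ℓ)`).
* [Castella2018] Prop. 2.5, proof (arXiv:1704.06608 p. 7): "For primes `v ∤ p` which are split in `K`, it
  is easy to see that the restriction map `H¹(K_v, M) → H¹(I_v, M)` is injective (see [PW11]), and so
  `ℋ_v^ur` vanishes. … a straightforward modification of the argument in [PW11] shows that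
  `ℋ_w^ur ≃ (ℤ_p/p^{t_E(w)}ℤ_p) ⊗ Λ^*`, where `t_E(w) := ord_p(c_w(E/K))`"; Thm. 2.3 (2.7) (p. 5):
  "`∏_{w∈Σ} #H¹(K_w, E[p^∞])`".
* [PollackWeston2011] Lemma 3.2 (arXiv:math/0610694 p. 7): "If `ℓ` is inert or ramified in `K/ℚ`, then `ℓ`
  splits completely in `K_∞` and `ℋ_ℓ = H¹(K_ℓ, A_f) ⊗ Λ^∨` where `Λ^∨ = Hom_𝒪(Λ, F/𝒪)`".

## Transcription of the named fact

At a finite place `w ∤ p` of the imaginary quadratic `K` (`p ≥ 3`, `κ` anticyclotomic) with Euler datum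
`(Nw, t, c)` (`IsEulerDataAt`: `Nw = #k_w`, reduction type `t` of `E/K_w`, `c = κ(φ_w)`) and no Tamagawa
defect (`NoTamagawaDefect p t c`): the Pontryagin dual (Mathlib `CharacterModule`) of
`H¹(K_w, M)` — Mathlib's continuous cohomology `continuousCohomology 1` of the tree's big representation
`AnticyclotomicBigGaloisRep κ ρ_{E,p^∞}` (co-induced model on `A = E[p^∞]`, `primaryTorsionGaloisRep`)
restricted along the tree's decomposition map `localMap K (Sum.inl w) : Γ_{K_w} → Γ_K` — is a finitely
generated torsion `Λ = ℤ_p⟦T⟧`-module and `eulerFactor p ℤ_[p] Nw t c ∈ Ch_Λ` of it. At the FINITELY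
DECOMPOSED `w` (`c ≠ 0`; every `w` over a prime split in `K`, Brink 2007) `H¹(K_w, M) ≅ H¹(I_w, M)^{D_w/I_w}`
(Cas18: `ℋ_w^ur = 0`) whose dual has characteristic ideal `(P_w(Ψ⁻¹ε⁻¹(frob_w)))` (Ski16 §2.3 = GV00 2.4 =
the JSW local display), and `eulerFactor` is that generator up to a unit of `Λ` (Skinner's convention,
module docstring of `SigmaEulerFactors`); at the TOTALLY SPLIT `w` (`c = 0`) `H¹(K_w, M) ≅ H¹(K_w, E[p^∞]) ⊗ Λ^∨`
(PW11 L. 3.2), dual `H¹(K_w, E[p^∞])^∨ ⊗ Λ` of characteristic ideal `(#H¹(K_w, E[p^∞])) = (#E(K_w)[p^∞])`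
(Cas18 (2.7); local Euler characteristic at `ℓ ≠ p`), which CONTAINS the constant `eulerFactor … 0 =
Nw + 1 − a_w ∕ Nw ∓ 1 ∕ 1` exactly when `p ∤ c_w(E/K_w)` — the content of the no-defect binder (module
docstring of `SigmaImprimitiveCharIdeal`, "Correction"). Stated as MEMBERSHIP (`P_w ∈ Ch`), the half the
`Σ`-change containment uses; the printed statements give equality at finitely decomposed `w`.
-- TODO(general form): equality `Ch_Λ(H¹(K_w, M)^∨) = (P_w)` at finitely decomposed `w`, and the statement
-- for a general number field `K` ∕ `ℤ_p`-extension (only `w ∤ p` and `κ(D_w)` matter), as in [GV00] ∕ [Ski16].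

References: [JetchevSkinnerWan2017] §5.1, proof of Thm. 6.1.6; [Skinner2016PacificMC] §2.3 (p. 180);
[GreenbergVatsal2000] Prop. 2.4; [Castella2018] Thm. 2.3 (2.7), Prop. 2.5; [PollackWeston2011] Lemma 3.2;
[SkinnerUrban2014] Prop. 3.2.3; [Brink2007] Thm. 2.
-/

noncomputable section

open scoped Classical
open WeierstrassCurve NumberField IsDedekindDomain Field
open Literature.NumberTheory.EllipticCurves Literature.NumberTheory.EllipticCurves.Castella2018
  Literature.NumberTheory.EllipticCurves.IwasawaCharacter Literature.NumberTheory.EllipticCurves.BigGaloisRep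
  Literature.NumberTheory.GaloisRepresentations

namespace Literature.NumberTheory.EllipticCurves.JetchevSkinnerWan2017

/-! ### The named fact: the local term at one place `w ∤ p` -/

/-- **The local term of the `Σ`-change at a place `w ∤ p` (Jetchev–Skinner–Wan 2017, proof of Thm. 6.1.6,
local display; Skinner 2016 §2.3; Greenberg–Vatsal 2000 Prop. 2.4; at the totally split places
Pollack–Weston 2011 Lemma 3.2 with Castella 2018 (2.7) ∕ Prop. 2.5), AWAY FROM THE TAMAGAWA DEFECT:** for
`E/ℚ`, `p ≥ 3`, `K` imaginary quadratic, `κ` the anticyclotomic `ℤ_p`-extension, a finite place `w ∤ p` of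
`K` with Euler datum `(Nw, t, c)` and `NoTamagawaDefect p t c`, the Pontryagin dual of
`H¹(K_w, T_pE ⊗ Λ^*(Ψ⁻¹))` (continuous `H¹` of the tree's co-induced big representation restricted to the
decomposition group at `w`) is a finitely generated torsion `Λ`-module whose characteristic ideal contains
the Euler factor `P_w = eulerFactor p ℤ_[p] Nw t c` ("`χ_Λ(Hom_𝒪(H¹(𝒦_w, M)/H¹_{𝔉_ac}(𝒦_w, M), L/𝒪)) =
(P_w(ε⁻¹Ψ⁻¹(Frob_w)))`"; "the `Λ_𝒪`-characteristic ideal of its Pontryagin dual is generated by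
`P_ℓ(Ψ⁻¹ε⁻¹(frob_ℓ))`"; "`ℋ_ℓ = H¹(K_ℓ, A_f) ⊗ Λ^∨`" at the totally split `ℓ`, of characteristic ideal
`(#H¹(K_w, E[p^∞])) ∋ P_w(Nw⁻¹)` when `p ∤ c_w`). Stated for every topology on `Λ` making the action
continuous (the groups do not depend on it), as membership (the half used by the `Σ`-change containment).
[cite: JetchevSkinnerWan2017, proof of Thm. 6.1.6 (arXiv:1512.06894 tex p0026 L82–96, the local factor `χ_Λ(Hom_𝒪(H¹(𝒦_w,M)/H¹_{𝔉_ac}(𝒦_w,M), L/𝒪)) = (P_w(ε⁻¹Ψ⁻¹(Frob_w)))`) and §5.1 Remark (inert `w`)]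
[cite: Skinner2016PacificMC, §2.3 (p. 180, "cotorsion … characteristic ideal of its Pontryagin dual is generated by `P_ℓ(Ψ⁻¹ε⁻¹(frob_ℓ))`")]
[cite: GreenbergVatsal2000, Prop. 2.4 (`ℓ ≠ p`: `ℋ_ℓ^∨` torsion, characteristic ideal `(P_ℓ(ℓ⁻¹γ_ℓ))`)]
[cite: PollackWeston2011, Lemma 3.2 (arXiv:math/0610694 p. 7, "`ℋ_ℓ = H¹(K_ℓ, A_f) ⊗ Λ^∨`" at inert or ramified `ℓ`)]
[cite: Castella2018, Thm. 2.3 (2.7) and Prop. 2.5 with its proof (arXiv:1704.06608 pp. 5, 7)] -/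
def sigmaLocal_charIdeal_eulerFactor_mem_of_noTamagawaDefect : Prop :=
  ∀ (W : WeierstrassCurve ℚ) [W.IsElliptic] (p : ℕ) [Fact p.Prime], 3 ≤ p →
    ∀ (K : Type) [Field K] [NumberField K], IsImaginaryQuadratic K →
    ∀ (κ : ZpExtension K p), κ.IsAnticyclotomic →
    ∀ (w : HeightOneSpectrum (𝓞 K)), ((p : ℕ) : 𝓞 K) ∉ w.asIdeal →
    ∀ (Nw : ℕ) (t : LocalReductionData) (c : ℤ_[p]),
      IsEulerDataAt (W.baseChange K) κ w Nw t c → NoTamagawaDefect p t c →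
    ∀ [TopologicalSpace (IwasawaAlgebra p)]
      [ContinuousSMul (IwasawaAlgebra p)
        (BigRepModule ℤ_[p] p (PrimaryTorsion (geomPoints (W.baseChange K)) p))],
      Module.Finite (IwasawaAlgebra p) (CharacterModule (continuousCohomology 1
        ((AnticyclotomicBigGaloisRep κ ((W.baseChange K).primaryTorsionGaloisRep p)).restrict
          (localMap K (Sum.inl w))).toTopRep)) ∧
      Module.IsTorsion (IwasawaAlgebra p) (CharacterModule (continuousCohomology 1
        ((AnticyclotomicBigGaloisRep κ ((W.baseChange K).primaryTorsionGaloisRep p)).restrict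
          (localMap K (Sum.inl w))).toTopRep)) ∧
      eulerFactor p ℤ_[p] Nw t c ∈ Module.charIdeal (IwasawaAlgebra p) (CharacterModule
        (continuousCohomology 1
          ((AnticyclotomicBigGaloisRep κ ((W.baseChange K).primaryTorsionGaloisRep p)).restrict
            (localMap K (Sum.inl w))).toTopRep))


end Literature.NumberTheory.EllipticCurves.JetchevSkinnerWan2017

end
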